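import Summits.QuantumFields.YangMills.Theorems.BalabanUVNodesN18AtRecordOfKernelLetters
import Summits.QuantumFields.YangMills.Theorems.BalabanUVNodesN22AtU3OfKernelsLimitExistence
import Summits.QuantumFields.YangMills.Theorems.BalabanUVNodesD4KernelDecayOfWindowed

/-!
# BalabanUVNodes ∕ N18 — (1.21) WITH A RATE FROM THE GEOMETRIC VOLUME-INCREMENTS LETTER, AND NODE N18's KERNEL LETTER ∕ THE THREE
# KERNEL-SIDE U3 INPUTS IN FINITE-VOLUME-STABILISATION CURRENCY
# (Track A, DAG node N18 = NE5 `T4OutputRate.NE5`; cluster K4 «SpineRates»; key K3⁷ `SpineGivenEndpointR13SepCoPH` = stmt-QuantumFields-20544, skeleton v5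
# 941dddb108cbaacf; cell `pub-ymgap`, WIDTH SEAT `pub-ymgap-dag-n18-w2` g6; `--kind proof --supports stmt-QuantumFields-20544 --as helper`, COUNT-NEUTRAL)

WHY.  node00-def-W1's W1-19b `Node00/U3KernelLetters` (p595370) names FOUR finite-volume letters for node U3's kernel inputs and ONE existence letter,
`PolLimitsExist(OfRecord₁₃)` — [I] p. 264 «This limit exists by the localized representation (1.7)».  The finite-volume MECHANISM behind that sentence is
W1-19b's own letter `GeometricIncrements F ℰ ρ bV W r` ∕ `GeometricIncrementsOfRecord₁₃ F N θ r`: from some volume index on, consecutive windowed kernels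
differ by `≤ C r^K`.  Seat `dag-n22-w3` typed the estimate-free EXISTENCE half in raw shape for the N22 row (`…N22AtU3OfKernelsLimitExistence`, p595960); no
Theorems file consumed the LETTER, none stated the RATE, and node N18's letter `KernelStepRateOfRecord₁₃` ∕ the (5.10) clause of record `KernelDecayOfRecord₁₃`
were still keyed to the existence letter.  THIS FILE (theorems only; 0 `def`, 0 `sorry`):
* §0 two real-line lemmas: `tendsto_of_eventually_geometric` (increments `≤ C r^K` from `K₀` on, `r < 1` ⇒ convergent — `cauchySeq_of_le_geometric` after an index
  shift) and ★ `abs_sub_le_of_eventually_geometric_of_tendsto` (THE TAIL: for `K ≥ K₀`, `|a K − lim| ≤ C r^K ∕ (1 − r)` — `dist_le_of_le_geometric_of_tendsto`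
  shifted; no sign hypothesis on `C` or `r`).
* §1 generic term family `ℰ`: `polLimitsExist_of_geometricIncrements` (the letter ⇒ `PolLimitsExist`, = n22-w3's raw-shape theorem AT THE LETTER NAMES),
  `polLimitsExistBox_of_geometricIncrements`, ★ `abs_polWindow_sub_kernelA_le_of_geometricIncrements` — THE QUANTITATIVE (1.21): for every `g` of the window
  and every entry `(k, μ, ν, z)` there are `K₀, C` with `|Π^{(K)}_{k+1,μν}(g_0,…,g_k; z) − Π_{k+1,μν}(g_0,…,g_k; z)| ≤ C r^K ∕ (1 − r)` for all `K ≥ K₀`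
  (`Π = kernelA`, W1-19's limiting kernel) —, `kernelStepRate_of_geometricIncrements_of_windowed` (+ the windowed two-run step rate ⇒ node N18's letter
  `KernelStepRate`, via dag-n18-w1's `kernelStepRate_of_windowed'`), `n18At_u3OfRecord₁₃_objects_of_geometricIncrements_of_windowed`.
* §2 at the record (Stage 13, edition-neutral `θ : Stage13Params F N`): `polLimitsExistOfRecord₁₃_of_geometricIncrements` (+ box form),
  ★ `abs_polWindow_sub_kernelA_le_of_geometricIncrementsOfRecord₁₃`, ★ `kernelStepRateOfRecord₁₃_of_geometricIncrements_of_windowed`,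
  `n18At_u3OfRecord₁₃_objectsOfRecord₁₃_of_geometricIncrements_of_windowed`, `kernelDecayOfRecord₁₃_of_geometricIncrements_of_windowedDecay` (the (5.10)
  clause of record via dag-n22-w3's `kernelDecayOfRecord₁₃_of_windowed`), `n22At_u3OfRecord₁₃_objectsOfRecord₁₃_of_geometricIncrements_of_windowedNE9`
  (dag-n22-w3's increments theorem at the letter names), and ★★ `u3KernelInputs_of_finiteVolumeLetters`: the THREE KERNEL-SIDE INPUTS `hdec ∕ h18 ∕ h22` of
  dag-n27-w1's (Kꜰ) `pHolderD4Body_rateCarriers_of_kernels_pin` (the u3 block of K3⁷ v5's `PHolderD4` at a kernel-pinned reading) from `ℓ.Signs` and FOUR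
  FINITE-VOLUME letters of record — `GeometricIncrementsOfRecord₁₃ … r` (`r < 1`), `WindowedStepRateOfRecord₁₃ … s ℓ.κ ℓ.θ₅ (ℓ.C₅·ℓ.θ₅)`,
  `WindowedNE9OfRecord₁₃ … ℓ.κ ℓ.moduli`, `WindowedDecayOfRecord₁₃ … 0 1 ℓ.κ` —: the (1.21)-existence letter is ELIMINATED from the kernel-side bill.
* §3 under the K3⁷ reading pin `hpin : (𝔯.lit F θ hP g₀ os).u3 = objectsOfRecord₁₃ F N θ.toStage13Params ℓ` (v3–v5 `U3PinnedKernels 𝔯 ℓ'` at the tuple):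
  ★★ `n18At_rateCarriers_of_kernels_pin_of_geometricIncrements` (the N18 conjunct of `RatesHolderAt` at EVERY run-length bundle of record) and
  `n22At_rateCarriers_of_kernels_pin_of_geometricIncrements` (dag-n22-w3's pin form at the letter names).

HONEST FRAMING.  Count-neutral LOCATED bookkeeping plus two lemmas on real sequences.  The increments letter and the three windowed letters are DISPLAYED
HYPOTHESES on Bałaban's merged term (1.6) — the volume-increment bound is the quantitative content of [I] p. 264's existence sentence and is NOT displayed in
print as such; the windowed two-run step rate is [I] Thm 1 p. 259 read at finite volume (NE5 for Bałaban's outputs is NOT PRINTED for d = 4: [I] p. 251 defers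
«the analysis of the Callan–Symanzik equations … to another paper», unpublished; C. King's (3.73) is the printed MODEL); nothing of Bałaban's is asserted or
instantiated; no inhabitant of any letter or of `Provisos₁₃CoPH` is claimed; N18 ∕ N22 ∕ (D4) NOT discharged; K3⁷ OPEN, not claimed; counts UNMOVED
(typed 28∕28 · discharged 5∕27, A 5∕28).  One finite four-torus programme at fixed ε — R4 closes the conditional rung `BalabanLadder.UV` only: NOT ℝ⁴,
NOT infinite volume, NOT OS, NOT a mass gap, NOT Clay.  Nothing landed is edited or re-declared (dag-n18-w1 p597580, dag-n22-w3 p595960 ∕ `…D4KernelDecayOfWindowed`,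
def-W1 W1-19b consumed BY NAME).

Sources (types only): T. Bałaban, Comm. Math. Phys. **109** (1987) 249–301 [Balaban1987RG1] — Thm 1 p. 259, (1.18) p. 263, (1.20)–(1.22) p. 264, (5.10) p. 293,
p. 251, p. 298; **116** (1988) 1–22 [Balaban1988RG2Cluster] (2.13)–(2.14) pp. 14–15.  No claim about the Yang–Mills mass gap.
-/

noncomputable section

open Filter Topology
open scoped BigOperators

namespace YMDAG.N18.PolLimitRate

open Literature.MathematicalPhysics.QuantumFieldTheory.Balaban1983to89
open Literature.MathematicalPhysics.QuantumFieldTheory.Balaban1983to89.T4Continuum (T4Family ULoop)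
open Literature.MathematicalPhysics.QuantumFieldTheory.Balaban1983to89.T4OutputRate (Window)
open Literature.MathematicalPhysics.QuantumFieldTheory.Balaban1983to89.Node00 (TermFamily1 polWindow polLimit PolLimitExists tendsto_polLimit
  mergedTermFamilyMatT TβOfRecord₁₃ chiβOfRecord₁₃ Stage13Params Stage13HParams U3Letters₁₁)
open Literature.MathematicalPhysics.QuantumFieldTheory.Balaban1983to89.Node00.U3OfKernels (histPrefix kernelA objects objectsOfRecord₁₃ KernelDecayOfRecord₁₃)
open Literature.MathematicalPhysics.QuantumFieldTheory.Balaban1983to89.Node00.U3KernelLetters (PolLimitsExist PolLimitsExistBox GeometricIncrements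
  WindowedStepRate KernelStepRate PolLimitsExistOfRecord₁₃ PolLimitsExistBoxOfRecord₁₃ GeometricIncrementsOfRecord₁₃ WindowedStepRateOfRecord₁₃
  KernelStepRateOfRecord₁₃ WindowedNE9OfRecord₁₃ WindowedDecayOfRecord₁₃)
open Literature.MathematicalPhysics.QuantumFieldTheory.Balaban1983to89.B12Sec2to5 (l1)
open YMDAG.N18.AtRecordOfKernelLetters (n18At_u3OfRecord₁₃_objects_iff_kernelStepRate_letter kernelStepRate_of_windowed'
  n18At_u3OfRecord₁₃_objectsOfRecord₁₃_of_kernelStepRateOfRecord₁₃ n18At_rateCarriers_of_kernels_pin_of_kernelStepRateOfRecord₁₃)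
open YMDAG.N22.AtKernels (polLimitExists_histories_of_geometric_increments kernelDecayOfRecord₁₃_of_windowed
  n22At_u3OfRecord₁₃_objectsOfRecord₁₃_of_windowed n22At_rateCarriers_of_kernels_pin)
open YMDAG.UVSplit (N18At N22At u3OfRecord₁₃ RateReading₁₃CoPH rateCarriersOfRecord₁₃CoPH)

/-! ## §0 Two real-line lemmas: geometric increments from a threshold on -/

/-- **GEOMETRIC INCREMENTS FROM A THRESHOLD ON ⇒ CONVERGENCE**: a real sequence whose consecutive increments are `≤ C r^K` for all `K ≥ K₀`, with `r < 1`,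
converges (the shifted sequence `n ↦ a (n + K₀)` has increments `≤ (C r^{K₀}) r^n`, `cauchySeq_of_le_geometric`, ℝ complete, `tendsto_add_atTop_iff_nat`).
No sign hypothesis on `C` or `r`. [cite: Balaban1987RG1, (1.21) p.264 (bookkeeping: the real line)] -/
theorem tendsto_of_eventually_geometric {a : ℕ → ℝ} {r C : ℝ} {K₀ : ℕ} (hr : r < 1) (h : ∀ K ≥ K₀, |a (K + 1) - a K| ≤ C * r ^ K) :
    ∃ P : ℝ, Tendsto a atTop (𝓝 P) := by
  have hcau : CauchySeq fun n : ℕ => a (n + K₀) := by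
    refine cauchySeq_of_le_geometric r (C * r ^ K₀) hr fun n => ?_
    rw [Real.dist_eq, abs_sub_comm, Nat.add_right_comm n 1 K₀, mul_assoc, ← pow_add, add_comm K₀ n]
    exact h (n + K₀) (Nat.le_add_left K₀ n)
  obtain ⟨P, hP⟩ := cauchySeq_tendsto_of_complete hcau
  exact ⟨P, (tendsto_add_atTop_iff_nat K₀).1 hP⟩

/-- ★ **THE TAIL**: under the same hypothesis, if `a → P` then `|a K − P| ≤ C r^K ∕ (1 − r)` for every `K ≥ K₀` (`dist_le_of_le_geometric_of_tendsto` for the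
shifted sequence with constant `C r^{K₀}`).  No sign hypothesis on `C` or `r`. [cite: Balaban1987RG1, (1.21) p.264 (bookkeeping: the real line)] -/
theorem abs_sub_le_of_eventually_geometric_of_tendsto {a : ℕ → ℝ} {r C P : ℝ} {K₀ : ℕ} (hr : r < 1)
    (h : ∀ K ≥ K₀, |a (K + 1) - a K| ≤ C * r ^ K) (hP : Tendsto a atTop (𝓝 P)) {K : ℕ} (hK : K₀ ≤ K) :
    |a K - P| ≤ C * r ^ K / (1 - r) := by
  have hu : ∀ n : ℕ, dist (a (n + K₀)) (a (n + 1 + K₀)) ≤ C * r ^ K₀ * r ^ n := fun n => by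
    rw [Real.dist_eq, abs_sub_comm, Nat.add_right_comm n 1 K₀, mul_assoc, ← pow_add, add_comm K₀ n]
    exact h (n + K₀) (Nat.le_add_left K₀ n)
  have hP' : Tendsto (fun n : ℕ => a (n + K₀)) atTop (𝓝 P) := (tendsto_add_atTop_iff_nat K₀).2 hP
  obtain ⟨n, rfl⟩ := Nat.exists_eq_add_of_le' hK
  have hd := dist_le_of_le_geometric_of_tendsto r (C * r ^ K₀) hr hu hP' n
  rw [Real.dist_eq, mul_assoc, ← pow_add, add_comm K₀ n] at hd
  exact hd

/-- The tail at the `limUnder` value (the tree's TOTAL limits are `limUnder`s). [cite: Balaban1987RG1, (1.21) p.264 (bookkeeping)] -/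
theorem abs_sub_limUnder_le_of_eventually_geometric {a : ℕ → ℝ} {r C : ℝ} {K₀ : ℕ} (hr : r < 1)
    (h : ∀ K ≥ K₀, |a (K + 1) - a K| ≤ C * r ^ K) {K : ℕ} (hK : K₀ ≤ K) :
    |a K - limUnder atTop a| ≤ C * r ^ K / (1 - r) :=
  abs_sub_le_of_eventually_geometric_of_tendsto hr h (tendsto_nhds_limUnder (tendsto_of_eventually_geometric hr h)) hK

/-! ## §1 Generic term family `ℰ`: the letter ⇒ existence, the (1.21) RATE, node N18's letter -/

section Generic

variable {𝔄 : Type*} [NormedRing 𝔄] [NormedAlgebra ℝ 𝔄]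
variable {V : Type*} [NormedAddCommGroup V] [NormedSpace ℝ V] {ι : Type*} [Fintype ι]
variable (F : T4Family) (ℰ : TermFamily1 F 𝔄) (ρ : V →L[ℝ] 𝔄) (bV : Module.Basis ι ℝ V)
variable {N : ℕ} [NeZero N]

/-- **THE INCREMENTS LETTER ⇒ THE EXISTENCE LETTER** (`r < 1`): W1-19b's `GeometricIncrements F ℰ ρ bV W r` gives `PolLimitsExist F ℰ ρ bV W` — dag-n22-w3's
`polLimitExists_histories_of_geometric_increments` AT THE LETTER NAMES (the `∀ K ≥ K₀` binder is `K₀ ≤ K`). [cite: Balaban1987RG1, (1.21) p.264] -/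
theorem polLimitsExist_of_geometricIncrements {W : Set (ℕ → ℝ)} {r : ℝ} (hr : r < 1) (h : GeometricIncrements F ℰ ρ bV W r) :
    PolLimitsExist F ℰ ρ bV W :=
  polLimitExists_histories_of_geometric_increments F ℰ ρ bV hr h

/-- The BOX form node N18's producer reads (`PolLimitsExist.box`). [cite: Balaban1987RG1, (1.21) p.264] -/
theorem polLimitsExistBox_of_geometricIncrements {γ r : ℝ} (hr : r < 1) (h : GeometricIncrements F ℰ ρ bV (Window γ) r) :
    PolLimitsExistBox F ℰ ρ bV γ :=
  (polLimitsExist_of_geometricIncrements F ℰ ρ bV hr h).box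

/-- ★ **THE QUANTITATIVE (1.21)**: under the increments letter (`r < 1`), for every coupling sequence `g` of the window and every kernel entry `(k, μ, ν, z)`
there are `K₀, C` with `|Π^{(K)}_{k+1,μν}(g_0, …, g_k; z) − Π_{k+1,μν}(g_0, …, g_k; z)| ≤ C r^K ∕ (1 − r)` for all `K ≥ K₀` — the windowed finite-volume kernel
is geometrically close to W1-19's LIMITING kernel `kernelA F ℰ ρ bV g k` (= `polLimit …`, a `limUnder`, which IS the limit here).  The `K₀, C` are the letter's.
[cite: Balaban1987RG1, (1.20)–(1.21) p.264] -/
theorem abs_polWindow_sub_kernelA_le_of_geometricIncrements {W : Set (ℕ → ℝ)} {r : ℝ} (hr : r < 1) (h : GeometricIncrements F ℰ ρ bV W r) :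
    ∀ g ∈ W, ∀ (k : ℕ) (μ ν : Fin 4) (z : Fin 4 → ℤ), ∃ (K₀ : ℕ) (C : ℝ), ∀ K ≥ K₀,
      |polWindow F K (k + 1) (ℰ k (histPrefix g k) K) ρ bV μ ν z - kernelA F ℰ ρ bV g k μ ν z| ≤ C * r ^ K / (1 - r) := by
  intro g hg k μ ν z
  obtain ⟨K₀, C, hC⟩ := h g hg k μ ν z
  refine ⟨K₀, C, fun K hK => ?_⟩
  have hP := tendsto_polLimit F (k + 1) (fun K => ℰ k (histPrefix g k) K) ρ bV
    (polLimitsExist_of_geometricIncrements F ℰ ρ bV hr h g hg k) μ ν z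
  exact abs_sub_le_of_eventually_geometric_of_tendsto hr hC hP hK

variable {ℰ}

/-- ★ **NODE N18's LETTER FROM THE INCREMENTS LETTER AND THE WINDOWED TWO-RUN STEP RATE** (both finite-volume statements): `GeometricIncrements … (Window γ) r`
(`r < 1`) and `WindowedStepRate … γ s κ θ (C₅·θ)` give `KernelStepRate … γ κ θ C₅` (dag-n18-w1's `kernelStepRate_of_windowed'` behind
`polLimitsExist_of_geometricIncrements`). [cite: Balaban1987RG1, Thm 1 p.259 and (1.20)–(1.21) p.264] -/
theorem kernelStepRate_of_geometricIncrements_of_windowed {γ κ θ C₅ r : ℝ} (s : ℕ) (hr : r < 1)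
    (hinc : GeometricIncrements F ℰ ρ bV (Window γ) r) (hfin : WindowedStepRate F ℰ ρ bV γ s κ θ (C₅ * θ)) :
    KernelStepRate F ℰ ρ bV γ κ θ C₅ :=
  kernelStepRate_of_windowed' F ρ bV s (polLimitsExist_of_geometricIncrements F ℰ ρ bV hr hinc) hfin

variable (ℰ)

/-- The N18 slot at the ₁₃ bundle of the kernel objects from the increments letter and the windowed two-run step rate at the letter block's `(κ, θ₅, C₅)`.
[cite: Balaban1987RG1, Thm 1 p.259 and (1.21) p.264] -/
theorem n18At_u3OfRecord₁₃_objects_of_geometricIncrements_of_windowed (θ : Stage13Params F N) (ℓ : U3Letters₁₁) (k s : ℕ) {r : ℝ} (hr : r < 1)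
    (hinc : GeometricIncrements F ℰ ρ bV (Window θ.γ) r) (hfin : WindowedStepRate F ℰ ρ bV θ.γ s ℓ.κ ℓ.θ₅ (ℓ.C₅ * ℓ.θ₅)) :
    N18At (u3OfRecord₁₃ θ (objects F ℰ ρ bV ℓ) k) :=
  (n18At_u3OfRecord₁₃_objects_iff_kernelStepRate_letter F ℰ ρ bV θ ℓ k).2
    (kernelStepRate_of_geometricIncrements_of_windowed F ρ bV s hr hinc hfin)

end Generic

/-! ## §2 At the record, Stage 13 (edition-neutral `θ : Stage13Params F N`) -/

section Record

open scoped Matrix.Norms.L2Operator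

variable (F : T4Family) (N : ℕ) [NeZero N]

/-- The increments letter of record (`r < 1`) gives the (1.21)-existence letter of record. [cite: Balaban1987RG1, (1.21) p.264] -/
theorem polLimitsExistOfRecord₁₃_of_geometricIncrements (θ : Stage13Params F N) {r : ℝ} (hr : r < 1) (h : GeometricIncrementsOfRecord₁₃ F N θ r) :
    PolLimitsExistOfRecord₁₃ F N θ := by
  letI := θ.instVβ₁; letI := θ.instVβ₂; letI := θ.instιβ
  exact polLimitsExist_of_geometricIncrements F _ θ.ρ8 θ.bV hr h

/-- … and its box form (node N18's producer input). [cite: Balaban1987RG1, (1.21) p.264] -/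
theorem polLimitsExistBoxOfRecord₁₃_of_geometricIncrements (θ : Stage13Params F N) {r : ℝ} (hr : r < 1) (h : GeometricIncrementsOfRecord₁₃ F N θ r) :
    PolLimitsExistBoxOfRecord₁₃ F N θ :=
  (polLimitsExistOfRecord₁₃_of_geometricIncrements F N θ hr h).box

/-- ★ **THE QUANTITATIVE (1.21) AT THE RECORD**: under `GeometricIncrementsOfRecord₁₃ F N θ r` (`r < 1`) every windowed kernel entry of the merged term family of
record in the record's β-chart is, from the letter's threshold on, within `C r^K ∕ (1 − r)` of the limiting (1.21) kernel of record.
[cite: Balaban1987RG1, (1.20)–(1.21) p.264] -/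
theorem abs_polWindow_sub_kernelA_le_of_geometricIncrementsOfRecord₁₃ (θ : Stage13Params F N) {r : ℝ} (hr : r < 1)
    (h : GeometricIncrementsOfRecord₁₃ F N θ r) :
    letI := θ.instVβ₁; letI := θ.instVβ₂; letI := θ.instιβ
    ∀ g ∈ Window θ.γ, ∀ (k : ℕ) (μ ν : Fin 4) (z : Fin 4 → ℤ), ∃ (K₀ : ℕ) (C : ℝ), ∀ K ≥ K₀,
      |polWindow F K (k + 1) (mergedTermFamilyMatT F N (TβOfRecord₁₃ F N) (chiβOfRecord₁₃ F N θ) θ.εbg k (histPrefix g k) K) θ.ρ8 θ.bV μ ν z -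
          kernelA F (mergedTermFamilyMatT F N (TβOfRecord₁₃ F N) (chiβOfRecord₁₃ F N θ) θ.εbg) θ.ρ8 θ.bV g k μ ν z| ≤ C * r ^ K / (1 - r) := by
  letI := θ.instVβ₁; letI := θ.instVβ₂; letI := θ.instιβ
  exact abs_polWindow_sub_kernelA_le_of_geometricIncrements F _ θ.ρ8 θ.bV hr h

/-- ★ **NODE N18's LETTER OF RECORD FROM TWO FINITE-VOLUME LETTERS OF RECORD**: `GeometricIncrementsOfRecord₁₃ F N θ r` (`r < 1`) and
`WindowedStepRateOfRecord₁₃ F N θ s κ θ₅ (C₅·θ₅)` give `KernelStepRateOfRecord₁₃ F N θ κ θ₅ C₅`. [cite: Balaban1987RG1, Thm 1 p.259 and (1.20)–(1.21) p.264] -/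
theorem kernelStepRateOfRecord₁₃_of_geometricIncrements_of_windowed (θ : Stage13Params F N) {κ θ₅ C₅ r : ℝ} (s : ℕ) (hr : r < 1)
    (hinc : GeometricIncrementsOfRecord₁₃ F N θ r) (hfin : WindowedStepRateOfRecord₁₃ F N θ s κ θ₅ (C₅ * θ₅)) :
    KernelStepRateOfRecord₁₃ F N θ κ θ₅ C₅ :=
  YMDAG.N18.AtRecordOfKernelLetters.kernelStepRateOfRecord₁₃_of_windowed' F N θ s
    (polLimitsExistOfRecord₁₃_of_geometricIncrements F N θ hr hinc) hfin

/-- N18 at the ₁₃ bundle of the objects of record from the two finite-volume letters of record at the letter block's `(κ, θ₅, C₅)`.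
[cite: Balaban1987RG1, Thm 1 p.259 and (1.21) p.264] -/
theorem n18At_u3OfRecord₁₃_objectsOfRecord₁₃_of_geometricIncrements_of_windowed (θ : Stage13Params F N) (ℓ : U3Letters₁₁) (k s : ℕ) {r : ℝ}
    (hr : r < 1) (hinc : GeometricIncrementsOfRecord₁₃ F N θ r) (hfin : WindowedStepRateOfRecord₁₃ F N θ s ℓ.κ ℓ.θ₅ (ℓ.C₅ * ℓ.θ₅)) :
    N18At (u3OfRecord₁₃ θ (objectsOfRecord₁₃ F N θ ℓ) k) :=
  n18At_u3OfRecord₁₃_objectsOfRecord₁₃_of_kernelStepRateOfRecord₁₃ F N θ ℓ k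
    (kernelStepRateOfRecord₁₃_of_geometricIncrements_of_windowed F N θ s hr hinc hfin)

/-- **THE (5.10) CLAUSE OF RECORD FROM TWO FINITE-VOLUME LETTERS OF RECORD**: `GeometricIncrementsOfRecord₁₃ F N θ r` (`r < 1`) and
`WindowedDecayOfRecord₁₃ F N θ μ ν κ` give `KernelDecayOfRecord₁₃ F N θ μ ν κ` (dag-n22-w3's `kernelDecayOfRecord₁₃_of_windowed` behind the existence letter).
[cite: Balaban1987RG1, (5.10) p.293 and (1.21) p.264] -/
theorem kernelDecayOfRecord₁₃_of_geometricIncrements_of_windowedDecay (θ : Stage13Params F N) (μ ν : Fin 4) {κ r : ℝ} (hr : r < 1)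
    (hinc : GeometricIncrementsOfRecord₁₃ F N θ r) (hW : WindowedDecayOfRecord₁₃ F N θ μ ν κ) : KernelDecayOfRecord₁₃ F N θ μ ν κ :=
  kernelDecayOfRecord₁₃_of_windowed F N θ μ ν κ (polLimitsExistOfRecord₁₃_of_geometricIncrements F N θ hr hinc) hW

/-- N22 at the ₁₃ bundle of the objects of record from `ℓ.Signs`, the increments letter of record and the windowed joint history-Lipschitz letter of record
(dag-n22-w3's `n22At_u3OfRecord₁₃_objectsOfRecord₁₃_of_increments_of_windowed` AT THE LETTER NAMES). [cite: Balaban1987RG1, (1.18) p.263 and (1.21) p.264] -/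
theorem n22At_u3OfRecord₁₃_objectsOfRecord₁₃_of_geometricIncrements_of_windowedNE9 (θ : Stage13Params F N) (ℓ : U3Letters₁₁) (hs : ℓ.Signs) (k : ℕ)
    {r : ℝ} (hr : r < 1) (hinc : GeometricIncrementsOfRecord₁₃ F N θ r) (h9 : WindowedNE9OfRecord₁₃ F N θ ℓ.κ ℓ.moduli) :
    N22At (u3OfRecord₁₃ θ (objectsOfRecord₁₃ F N θ ℓ) k) :=
  n22At_u3OfRecord₁₃_objectsOfRecord₁₃_of_windowed F N θ ℓ hs k (polLimitsExistOfRecord₁₃_of_geometricIncrements F N θ hr hinc) h9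

/-- ★★ **THE THREE KERNEL-SIDE U3 INPUTS FROM FINITE-VOLUME LETTERS ONLY**: the hypotheses `hdec ∕ h18 ∕ h22` of dag-n27-w1's (Kꜰ)
`pHolderD4Body_rateCarriers_of_kernels_pin` (the u3 block — (D4) read-out, N18, N22, and through them N17 — of K3⁷ v5's `PHolderD4 β` at a kernel-pinned reading)
hold at the tuple from `ℓ.Signs` and FOUR FINITE-VOLUME letters of record: the increments letter (`r < 1`), the windowed two-run step rate, the windowed joint
history-Lipschitz bounds, the windowed (5.10) bounds at the pair `(0, 1)`.  The (1.21)-existence letter no longer appears on the bill.  LOCATED: every letter a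
displayed hypothesis. [cite: Balaban1987RG1, Thm 1 p.259, (1.18) p.263, (1.21) p.264 and (5.10) p.293] -/
theorem u3KernelInputs_of_finiteVolumeLetters (θ : Stage13Params F N) (ℓ : U3Letters₁₁) (hs : ℓ.Signs) (s : ℕ) {r : ℝ} (hr : r < 1)
    (hinc : GeometricIncrementsOfRecord₁₃ F N θ r) (hfin : WindowedStepRateOfRecord₁₃ F N θ s ℓ.κ ℓ.θ₅ (ℓ.C₅ * ℓ.θ₅))
    (h9 : WindowedNE9OfRecord₁₃ F N θ ℓ.κ ℓ.moduli) (hW : WindowedDecayOfRecord₁₃ F N θ 0 1 ℓ.κ) :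
    KernelDecayOfRecord₁₃ F N θ 0 1 ℓ.κ ∧ (∀ k : ℕ, N18At (u3OfRecord₁₃ θ (objectsOfRecord₁₃ F N θ ℓ) k)) ∧
      ∀ k : ℕ, N22At (u3OfRecord₁₃ θ (objectsOfRecord₁₃ F N θ ℓ) k) :=
  ⟨kernelDecayOfRecord₁₃_of_geometricIncrements_of_windowedDecay F N θ 0 1 hr hinc hW,
    fun k => n18At_u3OfRecord₁₃_objectsOfRecord₁₃_of_geometricIncrements_of_windowed F N θ ℓ k s hr hinc hfin,
    fun k => n22At_u3OfRecord₁₃_objectsOfRecord₁₃_of_geometricIncrements_of_windowedNE9 F N θ ℓ hs k hr hinc h9⟩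

/-! ## §3 Under the K3⁷ reading pin (`U3PinnedKernels 𝔯 ℓ'` at the tuple, `ℓ := ℓ' F θ`) -/

variable {N}

/-- ★★ **THE N18 CONJUNCT OF A KERNEL-PINNED READING FROM TWO FINITE-VOLUME LETTERS OF RECORD**: under `hpin`, `GeometricIncrementsOfRecord₁₃` (`r < 1`) and
`WindowedStepRateOfRecord₁₃ … s ℓ.κ ℓ.θ₅ (ℓ.C₅·ℓ.θ₅)` give `N18At (rateCarriersOfRecord₁₃CoPH 𝔯 F θ hP g₀ os k).u3` at EVERY run length `k` — in particular at
the selected one of K3⁷ v5's `KeyedRatesHolderD4`.  LOCATED; N18 NOT discharged. [cite: Balaban1987RG1, Thm 1 p.259 and (1.20)–(1.21) p.264] -/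
theorem n18At_rateCarriers_of_kernels_pin_of_geometricIncrements (𝔯 : RateReading₁₃CoPH N) (θ : Stage13HParams F N) (hP : θ.Provisos₁₃CoPH F N)
    (g₀ : ℕ → ℝ) (os : List (ULoop F)) (ℓ : U3Letters₁₁) (hpin : (𝔯.lit F θ hP g₀ os).u3 = objectsOfRecord₁₃ F N θ.toStage13Params ℓ) (k s : ℕ)
    {r : ℝ} (hr : r < 1) (hinc : GeometricIncrementsOfRecord₁₃ F N θ.toStage13Params r)
    (hfin : WindowedStepRateOfRecord₁₃ F N θ.toStage13Params s ℓ.κ ℓ.θ₅ (ℓ.C₅ * ℓ.θ₅)) :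
    N18At (rateCarriersOfRecord₁₃CoPH 𝔯 F θ hP g₀ os k).u3 :=
  n18At_rateCarriers_of_kernels_pin_of_kernelStepRateOfRecord₁₃ F 𝔯 θ hP g₀ os ℓ hpin k
    (kernelStepRateOfRecord₁₃_of_geometricIncrements_of_windowed F N θ.toStage13Params s hr hinc hfin)

/-- The N22 conjunct of a kernel-pinned reading from `ℓ.Signs`, the increments letter of record and the windowed joint history-Lipschitz letter of record
(dag-n22-w3's `n22At_rateCarriers_of_kernels_pin` behind the existence letter, AT THE LETTER NAMES).  LOCATED; N22 NOT discharged.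
[cite: Balaban1987RG1, (1.18) p.263 and (1.21) p.264] -/
theorem n22At_rateCarriers_of_kernels_pin_of_geometricIncrements (𝔯 : RateReading₁₃CoPH N) (θ : Stage13HParams F N) (hP : θ.Provisos₁₃CoPH F N)
    (g₀ : ℕ → ℝ) (os : List (ULoop F)) (ℓ : U3Letters₁₁) (hs : ℓ.Signs)
    (hpin : (𝔯.lit F θ hP g₀ os).u3 = objectsOfRecord₁₃ F N θ.toStage13Params ℓ) {r : ℝ} (hr : r < 1)
    (hinc : GeometricIncrementsOfRecord₁₃ F N θ.toStage13Params r) (h9 : WindowedNE9OfRecord₁₃ F N θ.toStage13Params ℓ.κ ℓ.moduli) (k : ℕ) :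
    N22At (rateCarriersOfRecord₁₃CoPH 𝔯 F θ hP g₀ os k).u3 :=
  n22At_rateCarriers_of_kernels_pin 𝔯 θ hP g₀ os ℓ hs hpin
    (polLimitsExistOfRecord₁₃_of_geometricIncrements F N θ.toStage13Params hr hinc) h9 k

end Record

end YMDAG.N18.PolLimitRate

end
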